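import Summits.ResolutionOfSingularities.ResolutionOfSingularities.Theorems.WeightedInvariantHypersurfaceCentreAssemblyTorusHalf
import Summits.ResolutionOfSingularities.ResolutionOfSingularities.Theorems.WeightedInvariantHypersurfaceCentreAssemblyPlusStalk
import HarnessLib

/-!
# Door assembly H2c″ — [S6] TORUS HALF on the chart tier of the stalk chain (entry points for the composition)

Route `ResolutionOfSingularities/WeightedInvariant`, crux `Theses.WeightedInvariant.HypersurfaceCentreConstruction`
(stmt-ResolutionOfSingularities-19897), door line `local-engine`, skeleton v3.6, assembly stub **[S6]** `stub_iotaMax_lt_of_step`;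
plan of record `D/res-D-brk-1/S6-PLAN.md` (res-L1-w43-stub-9) and the owner's word «TRIM AND FILE» (STATUS 2026-08-27T09:22:10Z):
the composition consumes ONLY the chart tier of `…CentreAssemblyPlusStalk` (res-type-089 / res-D-pv-036) — the chart
`φ_U : Spec ⊕ₙ 𝒥ₙ(U) tⁿ ∖ V(⊕_{n>0}) ⟶ B₊`, K4-E (I) `exists_stalk_ringEquiv_of_plusChartFac` (the local ring of `B₊` at `φ_U x`
is `(⊕ₙ 𝒥ₙ(U) tⁿ)_q`, the stalk of a strict transform going to the `t⁻¹`-saturation) and K4-E (II)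
`primeIdealOf_πPlus_plusChartFac_asIdeal` (`q ∩ Γ(Y,U) = 𝔮_{π₊(φ_U x)}`).

This file turns res-type-057's TORUS HALF `iotaAt_lt_iotaMax_of_not_mem_maxLocus_of_stalkChain` (`…CentreAssemblyTorusHalf`,
p514626) into entry points on exactly that tier:
* `iotaAt_lt_iotaMax_of_not_mem_maxLocus_of_plusChart` — at a point `y′ ∈ singImage σˢ(X)|_{B₊}` over `U`, off the maximum
  locus, GIVEN the K4-E (I) model `Ψ₀ : 𝒪_{B₊,y′} ≃ (⊕ₙ 𝒥ₙ(U) tⁿ)_q` (clause at `K := X`, verbatim shape) and K4-E (II) (verbatim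
  orientation): `iotaAt ι σˢ(X)|_{B₊} y′ < iotaMax ι X` (the double extension `(X(U)·S)·S_q` is reshaped to `X(U)·S_q` here);
* `iotaAt_strictTransformPlus_lt_iotaMax_of_not_mem_maxLocus` — SELF-CONTAINED: only the data of a tower step (`R′.ideal = R.piece`
  for the canonical centre `R`, `B` locally Noetherian, `X` and `σˢ(X)|_{B₊}` locally principal); the chart reduction
  (`X` principal on an affine `U ∋ π₊ y′`, `y′ = φ_U x`, K4-E (I)/(II) at `x`) is done inside, so the torus branch of
  `stub_iotaMax_lt_of_step` is ONE `exact`;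
* `iotaAt_strictTransformPlus_lt_iotaMax_of_not_mem_support` — the same off `supp R` (`IsCanonicalCentre.support_eq`).

Def-free helper (`--supports stmt-ResolutionOfSingularities-19897`).  The clauses (c6), (c10), (c12a) are HYPOTHESES on an
arbitrary `ι`; nothing about Hironaka's problem is claimed.  AI-written; weaker than expert review.
-/

noncomputable section

set_option linter.dupNamespace false -- mandated namespace of this single-conjunct summit

open CategoryTheory AlgebraicGeometry TopologicalSpace IsLocalRing
open scoped LaurentPolynomial
open Literature.AlgebraicGeometry.Resolution
open Summit.ResolutionOfSingularities.ResolutionOfSingularities.Theorems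

namespace Summit.ResolutionOfSingularities.ResolutionOfSingularities.Cruxes.HypersurfaceCentreConstruction.LocalEngine

/-! ## [S6] TORUS HALF — entry points on the CHART TIER of `…AssemblyPlusStalk` -/

section TorusChart

variable (ι : (R : Type) → [CommRing R] → R → Ordinal.{0})
  (J : (R : Type) → [CommRing R] → R → ℕ → Ideal R)

/-- **[S6] TORUS HALF at a modelled point of `B₊`** (the form the composition calls right after K4-E (I)): for a Rees
filtration `R′` with the pieces of a canonical centre `R` of `(f, X)`, an affine `U`, a point `y′` of `B₊ = R′.plus` whose base
point lies in `U` and OFF the maximum locus, a prime `q` of the chart algebra `⊕ₙ 𝒥ₙ(U) tⁿ` and a ring isomorphism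
`Ψ₀ : 𝒪_{B₊,y′} ≃ (⊕ₙ 𝒥ₙ(U) tⁿ)_q` carrying the stalk of `X′ = σˢ(X)|_{B₊}` onto the `t⁻¹`-saturation of `X(U)` (K4-E (I),
`exists_stalk_ringEquiv_of_plusChartFac … |>.2 X`, VERBATIM shape) with `q ∩ Γ(Y,U) = 𝔮_{π₊ y′}` (K4-E (II),
`primeIdealOf_πPlus_plusChartFac_asIdeal`, VERBATIM orientation): if `y′` is a non-regular point of `V(X′)` then
`iotaAt ι X′ y′ < iotaMax ι X`.  Proof: reshape (I) to the single extension `X(U) · (⊕ₙ 𝒥ₙ(U) tⁿ)_q` (`Ideal.map_map`,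
`IsScalarTower.algebraMap_eq`) and call `iotaAt_lt_iotaMax_of_not_mem_maxLocus_of_stalkChain` with `Fch := R′.filtration U`.
[folklore] -/
theorem iotaAt_lt_iotaMax_of_not_mem_maxLocus_of_plusChart
    (hc6 : IotaIsoInvariant ι) (hc10 : IotaTorusFactorMonotone ι) (hu : IotaUnitInvariant ι)
    {k : Type} [Field k] {Y : Scheme.{0}} (f : Y ⟶ Spec (.of k)) [Smooth f]
    (X : Y.IdealSheafData) (hX : IsLocallyPrincipal X) {R : ReesAlgebraData Y} (hR : IsCanonicalCentre ι J X R)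
    (R' : ReesFiltration Y) (hR' : R'.ideal = R.piece) (hlp' : IsLocallyPrincipal (R'.strictTransformPlus X))
    (U : Y.affineOpens) (y' : (R'.plus : Scheme.{0})) (hyU : R'.πPlus y' ∈ (U : Y.Opens))
    (hy : R'.πPlus y' ∉ maxLocus ι X) (hy' : y' ∈ singImage (R'.strictTransformPlus X))
    (q : PrimeSpectrum (R'.sectionsRing U))
    (Ψ₀ : (R'.plus : Scheme.{0}).presheaf.stalk y' ≃+* Localization.AtPrime q.asIdeal)
    (hΨ₀ : (stalkIdeal (R'.strictTransformPlus X) y').map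
        (Ψ₀ : (R'.plus : Scheme.{0}).presheaf.stalk y' →+* Localization.AtPrime q.asIdeal) =
      ⨆ n : ℕ, (((X.ideal U).map (algebraMap Γ(Y, U) (R'.sectionsRing U))).map
        (algebraMap (R'.sectionsRing U) (Localization.AtPrime q.asIdeal))).colon
        {algebraMap (R'.sectionsRing U) (Localization.AtPrime q.asIdeal)
          ⟨LaurentPolynomial.T (-1), (R'.filtration U).T_neg_one_mem_extendedRees⟩ ^ n})
    (hq : (U.2.primeIdealOf ⟨R'.πPlus y', hyU⟩).asIdeal = q.asIdeal.comap (algebraMap Γ(Y, U) (R'.sectionsRing U))) :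
    iotaAt ι (R'.strictTransformPlus X) y' < iotaMax ι X := by
  -- reshape (I): `(X(U)·S)·S_q = X(U)·S_q`
  have hcomp : (algebraMap (R'.sectionsRing U) (Localization.AtPrime q.asIdeal)).comp
      (algebraMap Γ(Y, U) (R'.sectionsRing U)) = algebraMap Γ(Y, U) (Localization.AtPrime q.asIdeal) :=
    (IsScalarTower.algebraMap_eq Γ(Y, U) (R'.sectionsRing U) (Localization.AtPrime q.asIdeal)).symm
  have hI := hΨ₀
  simp only [Ideal.map_map, hcomp] at hI
  exact iotaAt_lt_iotaMax_of_not_mem_maxLocus_of_stalkChain ι J hc6 hc10 hu f X hX hR U (R'.filtration U)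
    (fun n => by rw [ReesFiltration.filtration_ideal, hR']) (R'.πPlus y') hyU hy (R'.strictTransformPlus X) hlp' y'
    q.asIdeal Ψ₀ hI hq.symm hy'

/-- **[S6] TORUS HALF, self-contained scheme-level form**: for the global cobordant blow-up `B₊ = R′.plus → Y` of a Rees
filtration `R′` with the pieces of a canonical centre `R` of `(f, X)` (`R′.ideal = R.piece`), `B` locally Noetherian, `X`
and `X′ = σˢ(X)|_{B₊}` locally principal: every NON-regular point `y′` of `V(X′)` whose base point `π₊ y′` lies OFF the
maximum locus of `ι` has `iotaAt ι X′ y′ < iotaMax ι X`.  Proof: an affine `U ∋ π₊ y′` with `X(U)` principal, the chart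
`φ_U` of `…AssemblyPlusStalk` through which `y′ = φ_U x` (`exists_plusChartFac_apply_eq`), K4-E (I)/(II) at `x`
(`exists_stalk_ringEquiv_of_plusChartFac`, `primeIdealOf_πPlus_plusChartFac_asIdeal`), then
`iotaAt_lt_iotaMax_of_not_mem_maxLocus_of_plusChart`. [folklore] -/
theorem iotaAt_strictTransformPlus_lt_iotaMax_of_not_mem_maxLocus
    (hc6 : IotaIsoInvariant ι) (hc10 : IotaTorusFactorMonotone ι) (hu : IotaUnitInvariant ι)
    {k : Type} [Field k] {Y : Scheme.{0}} (f : Y ⟶ Spec (.of k)) [Smooth f]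
    (X : Y.IdealSheafData) (hX : IsLocallyPrincipal X) {R : ReesAlgebraData Y} (hR : IsCanonicalCentre ι J X R)
    (R' : ReesFiltration Y) (hR' : R'.ideal = R.piece) [IsLocallyNoetherian R'.cobordantBlowup]
    (hlp' : IsLocallyPrincipal (R'.strictTransformPlus X))
    (y' : (R'.plus : Scheme.{0})) (hy' : y' ∈ singImage (R'.strictTransformPlus X))
    (hy : R'.πPlus y' ∉ maxLocus ι X) :
    iotaAt ι (R'.strictTransformPlus X) y' < iotaMax ι X := by
  obtain ⟨U, hyU, -, -⟩ := hX (R'.πPlus y')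
  have hφex := exists_plusChartFac R' U
  obtain ⟨φ, hφo, hφ⟩ := hφex
  have hxex := exists_plusChartFac_apply_eq R' U φ hφ y' hyU
  obtain ⟨x, rfl⟩ := hxex
  have hΨex := exists_stalk_ringEquiv_of_plusChartFac R' U φ hφ x ((R'.plusChart U).ι x) rfl
  obtain ⟨Ψ₀, hΨ₀⟩ := hΨex
  exact iotaAt_lt_iotaMax_of_not_mem_maxLocus_of_plusChart ι J hc6 hc10 hu f X hX hR R' hR' hlp' U (φ x) hyU hy hy'
    ((R'.plusChart U).ι x) Ψ₀ (hΨ₀ X) (primeIdealOf_πPlus_plusChartFac_asIdeal R' U φ hφ x _ rfl)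

/-- The same with the hypothesis on the SUPPORT of the centre (`IsCanonicalCentre.support_eq`; the name res-L1-w43-plan-1's
RULING gen 9 #1 (b) asked for). [folklore] -/
theorem iotaAt_strictTransformPlus_lt_iotaMax_of_not_mem_support
    (hc6 : IotaIsoInvariant ι) (hc10 : IotaTorusFactorMonotone ι) (hu : IotaUnitInvariant ι)
    {k : Type} [Field k] {Y : Scheme.{0}} (f : Y ⟶ Spec (.of k)) [Smooth f]
    (X : Y.IdealSheafData) (hX : IsLocallyPrincipal X) {R : ReesAlgebraData Y} (hR : IsCanonicalCentre ι J X R)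
    (R' : ReesFiltration Y) (hR' : R'.ideal = R.piece) [IsLocallyNoetherian R'.cobordantBlowup]
    (hlp' : IsLocallyPrincipal (R'.strictTransformPlus X))
    (y' : (R'.plus : Scheme.{0})) (hy' : y' ∈ singImage (R'.strictTransformPlus X))
    (hy : R'.πPlus y' ∉ R.support) :
    iotaAt ι (R'.strictTransformPlus X) y' < iotaMax ι X :=
  iotaAt_strictTransformPlus_lt_iotaMax_of_not_mem_maxLocus ι J hc6 hc10 hu f X hX hR R' hR' hlp' y' hy'
    (by rwa [← hR.support_eq])

end TorusChart

end Summit.ResolutionOfSingularities.ResolutionOfSingularities.Cruxes.HypersurfaceCentreConstruction.LocalEngine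

end
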